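import Summits.FinalStateConjecture.FinalStateConjecture.Theorems.SwallowTheDatumBurialIntoShieldedBackgroundSlice

/-!
# Route `SwallowTheDatum` · item `BurialIntoShieldedBackground` (stmt-FinalStateConjecture-14721) —
# the crux implies the background: `ParametricKerrBurial ↔ KerrShieldedDataExist ∧ item`

The item reads `KerrShieldedDataExist → ParametricKerrBurial` (route file rev 8; added by the route repair of
2026-08-16 to put the anti-vacuity crux `KerrShieldedDataExist` into the cone of `closes`).  This file records,
sorry-free and definition-free, the converse edge of that cone, which the tree did not yet state:

* `kerrShieldedDataExist_of_parametricKerrBurial` : **`ParametricKerrBurial → KerrShieldedDataExist`** — apply the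
  crux to the tree's admissible datum `(Minkowski.slice, trivialData)` (`trivialData_mem_admissibleVacuumData`), take
  the member `F c₁`, `c₁ = e₀ ≠ 0`, of the burial family (admissible and `IsKerrShielded`), and carry it to `ℝ³` along
  the identification `κ : ℝ³ ≅ Minkowski.slice` (`comap_mem_admissibleVacuumData`, `isKerrShielded_comap` of
  `SwallowTheDatumBurialIntoShieldedBackground.lean`).  So the anti-vacuity crux (stmt-FinalStateConjecture-10055) is a
  COROLLARY of the burial crux (stmt-FinalStateConjecture-10052);
* `parametricKerrBurial_iff_and` : `ParametricKerrBurial ↔ KerrShieldedDataExist ∧ BurialIntoShieldedBackground` —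
  the item is exactly the quotient "crux minus background";
* `iff_kerrShieldedDataExist_iff_parametricKerrBurial` : `BurialIntoShieldedBackground ↔ (KerrShieldedDataExist ↔
  ParametricKerrBurial)` — the item says precisely that the two cruxes are equivalent.

Consequently the item can close only together with the crux `ParametricKerrBurial` (by
`BurialIntoShieldedBackground.of_parametricKerrBurial`), or by a refutation of `KerrShieldedDataExist`.

References: route file `Theses/SwallowTheDatum.lean` rev 8 (items 14721, 10052, 10055); Christodoulou, CQG 16 (1999),
p. A24 (the admissible class and its trivial member); O'Neill 1983, Ch. 3, p. 58 (pullback along a diffeomorphism).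
-/

-- `Summit.<Summit>.<Problem>`: single-conjunct summit, the duplicate namespace component is mandated (CONVENTIONS §2).
set_option linter.dupNamespace false

noncomputable section

namespace Summit.FinalStateConjecture.FinalStateConjecture.Theorems.SwallowTheDatum.BurialIntoShieldedBackground

open scoped Manifold ContDiff Topology
open Bundle Set Function Literature.Geometry.Lorentzian
open Summit.FinalStateConjecture.FinalStateConjecture.Theses.SwallowTheDatum
  (ParametricKerrBurial KerrShieldedDataExist BurialIntoShieldedBackground)
open Summit.FinalStateConjecture.FinalStateConjecture.Theorems.SwallowTheDatum.ParametricKerrBurial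
  (IsKerrShielded crux_iff)

/-- **The burial crux implies the anti-vacuity crux**: `ParametricKerrBurial → KerrShieldedDataExist`.  The burial
family through the admissible trivial datum of `Minkowski.slice` has an admissible, Kerr-shielded member `F e₀`
(`e₀ ≠ 0`); its pullback along the identification `κ : ℝ³ → Minkowski.slice`, `κ y = ⟨y, _⟩` (a diffeomorphism with
`dκ = id`, inverse the inclusion), is an admissible Kerr-shielded datum on `ℝ³` (diffeomorphism invariance of the
admissible class and covariance of the shield).  Christodoulou, CQG 16 (1999), p. A24; O'Neill 1983, Ch. 3, p. 58.
[folklore] -/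
theorem kerrShieldedDataExist_of_parametricKerrBurial (h : ParametricKerrBurial) : KerrShieldedDataExist := by
  rw [kerrShieldedDataExist_iff]
  intro _
  -- the inclusion `ι : Minkowski.slice → ℝ³` and its inverse `κ`, as a diffeomorphism `Θ : ℝ³ ≅ Minkowski.slice`
  set ι : Minkowski.slice → E3 := Subtype.val with hι
  set κ : E3 → Minkowski.slice := fun y ↦ ⟨y, Minkowski.mem_slice y⟩ with hκ
  have hιs : ContMDiff (𝓡 3) (𝓡 3) (∞ + 1) ι := InitialDataSet.contMDiff_subtypeVal_succ _
  have hdι : ∀ u : Minkowski.slice, mfderiv (𝓡 3) (𝓡 3) ι u = ContinuousLinearMap.id ℝ E3 := fun u ↦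
    Literature.Geometry.Manifold.OpenSubmanifold.mfderiv_subtype_val u
  have hκs' : ContMDiff (𝓡 3) (𝓡 3) ∞ κ := (ContMDiff.subtypeVal_comp_iff _ κ).1 contMDiff_id
  have hκs : ContMDiff (𝓡 3) (𝓡 3) (∞ + 1) κ := hκs'.of_le (le_of_eq (by rfl))
  have hdκ : ∀ y : E3, mfderiv (𝓡 3) (𝓡 3) κ y = ContinuousLinearMap.id ℝ E3 := by
    intro y
    have h1 : mfderiv (𝓡 3) (𝓡 3) (ι ∘ κ) y =
        (mfderiv (𝓡 3) (𝓡 3) ι (κ y)).comp (mfderiv (𝓡 3) (𝓡 3) κ y) :=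
      mfderiv_comp y ((hιs.mdifferentiable (by simp)) (κ y)) ((hκs.mdifferentiable (by simp)) y)
    have h2 : ι ∘ κ = id := funext fun y ↦ rfl
    rw [h2, mfderiv_id, hdι] at h1
    rw [← ContinuousLinearMap.id_comp (mfderiv (𝓡 3) (𝓡 3) κ y)]
    exact h1.symm
  have hκ' : ∀ y, Injective (mfderiv (𝓡 3) (𝓡 3) κ y) := fun y ↦ by
    rw [hdκ]; exact fun v w h ↦ h
  let Θ : Diffeomorph (𝓡 3) (𝓡 3) E3 Minkowski.slice ∞ :=
    { toFun := κ
      invFun := ι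
      left_inv := fun y ↦ rfl
      right_inv := fun u ↦ rfl
      contMDiff_toFun := hκs'
      contMDiff_invFun := contMDiff_subtype_val }
  -- the burial family through the trivial datum and its member at `c₁ = e₀ ≠ 0`
  obtain ⟨F, -, -, -, hadm, hS⟩ :=
    (crux_iff.mp h) Minkowski.slice trivialData trivialData_mem_admissibleVacuumData
  set c₁ : EuclideanSpace ℝ (Fin 1) := EuclideanSpace.single 0 1 with hc₁
  have hc₁0 : c₁ ≠ 0 := by
    rw [Ne, eq_zero_iff_apply, hc₁]
    simp
  exact ⟨(F c₁).comap κ hκs hκ', comap_mem_admissibleVacuumData Θ hκs hκ' (hadm c₁),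
    isKerrShielded_comap Θ hκs hκ' (hS c₁ hc₁0)⟩

/-- **The crux is the background plus the item**: `ParametricKerrBurial ↔ KerrShieldedDataExist ∧
BurialIntoShieldedBackground` (`kerrShieldedDataExist_of_parametricKerrBurial` and weakening one way, modus ponens
the other). [folklore] -/
theorem parametricKerrBurial_iff_and :
    ParametricKerrBurial ↔ KerrShieldedDataExist ∧ BurialIntoShieldedBackground :=
  ⟨fun h ↦ ⟨kerrShieldedDataExist_of_parametricKerrBurial h, of_parametricKerrBurial h⟩,
    fun h ↦ parametricKerrBurial_of h.2 h.1⟩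

/-- **The item states the equivalence of the two cruxes**: `BurialIntoShieldedBackground ↔ (KerrShieldedDataExist ↔
ParametricKerrBurial)` — the forward implication is the item itself, the backward one is
`kerrShieldedDataExist_of_parametricKerrBurial`. [folklore] -/
theorem iff_kerrShieldedDataExist_iff_parametricKerrBurial :
    BurialIntoShieldedBackground ↔ (KerrShieldedDataExist ↔ ParametricKerrBurial) :=
  ⟨fun h ↦ ⟨fun hK ↦ parametricKerrBurial_of h hK, kerrShieldedDataExist_of_parametricKerrBurial⟩,
    fun h ↦ fun hK ↦ h.mp hK⟩

end Summit.FinalStateConjecture.FinalStateConjecture.Theorems.SwallowTheDatum.BurialIntoShieldedBackground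

end
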